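import Mathlib
import HarnessLib
import Summits.NavierStokesRegularity.NavierStokesRegularity.Theorems.UnthreadedDoorNetFluxDefs

/-!
# Route `UnthreadedDoor`, crux `PoloidalLiouville` (stmt-NavierStokesRegularity-1222), WALL W1 `stub_scalarLiouville` —
# crux idea «netflux-typei-gap» line v5 = VISCOSITY (planner ns-idea-14 g3; critic ns-wall-crit-1 V14 PASS-WITH-PRICE):
# THE TWO v5 INTERFACE STATEMENTS (L) `OneSidedNetFluxLaw` and (NC) `NearCentreFlux` (Theorems-side twin)

Definition file: Theorems-side twin of §0v of the line file `Cruxes/PoloidalLiouville/Lines/netflux_typei_gap.lean` (v5, crux-write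
bcd4955f0879, tree sha12 76db640682bd; namespace `…Theorems.PoloidalLiouville.NetFlux` instead of the line's
`…Cruxes.PoloidalLiouville.NetFlux`; the two def BODIES and their docstrings are VERBATIM; the objects `E3`, `netFlux`, `CurledLaw`,
`IsUnimodalSphere` are the Theorems-side twins of `UnthreadedDoorNetFluxDefs` (p660450), themselves verbatim).  Purpose: the NF-4ᵛ
composition `OneSidedNetFluxLaw → OscLeVorticity → NearCentreFlux → NetFluxWindowDecay` (line stub `stub_windowDecay_viscosity`)
can be stated and proved BY NAME under `Theorems/` without importing a crux workfile.  ((E) `EnvelopeFacts` is not copied: its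
Theorems-side statement is the type of `NetFlux.envelopeFacts`, p667268, ns-qj-p1 g4.)

WHAT THIS IS NOT: no NS-regularity statement is touched; `PoloidalLiouville` (1222), its wall and the line's rung target stay OPEN;
these are two typed interface statements of one crux idea (both still stubs of the line: NF-1cᵛ, NF-6).
`--supports stmt-NavierStokesRegularity-1222 --as helper`.  Author of the statements: planner ns-idea-14 g3; filed Theorems-side by
ARM A ns-exp-scalarLiouville g3.  [folklore]
-/

noncomputable section

-- the summit and its single sub-problem share the name (CONVENTIONS §1)
set_option linter.dupNamespace false

namespace Summit.NavierStokesRegularity.NavierStokesRegularity.Theorems.PoloidalLiouville.NetFlux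

open Set Function Filter Topology MeasureTheory
open scoped RealInnerProductSpace
open Literature.Analysis.FluidPDE

/-- **(L, the NS-side law in ONE-SIDED (viscosity-ready) form; replaces v4's distributional `NetFluxSubsolution`.)**
Same window data as `NetFluxSubsolution` (`v, T` smooth, `T` off the centre; `‖v(t,·)‖ ≤ V(t)`; `CurledLaw`; saddle-free spheres).
THEN `w(t,r) = netFlux (T t) x₀ r` is jointly continuous on `(t₀,0) × (0,∞)`, has right / left `r`-derivatives `ℓp, ℓm` at every
`r > 0`, and for all `0 < a < R` the truncated cumulative flux `W_a(t,R) = ∫_a^R w(t,r) dr` obeys the one-sided law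
  `limsup_{h↓0} [W_a(t,R) − W_a(t−h,R)]/h ≤ ℓp(t,R) − ℓm(t,a) + V(t)·(w(t,R) + w(t,a))`
(typed ε-δ).  Informally: `W_t ≤ W_RR + V W_R` tested at single points from the past, with the boundary fluxes at `r = a, R`
paid by the EMF bound `|I| ≤ V w`.  Derivation in the module docstring (slice inequality at spherical extrema + (E) + (A)).
Test functions never appear; `a > 0` keeps every estimate on compacts away from `x₀` (no boundedness of `T` at the centre is used). -/
def OneSidedNetFluxLaw : Prop :=
  ∀ (v : ℝ → E3 → E3) (x₀ : E3) (T : ℝ → E3 → ℝ) (V : ℝ → ℝ) (t₀ : ℝ),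
    ContDiffOn ℝ (⊤ : ℕ∞) (uncurry v) (Ioo t₀ 0 ×ˢ univ) →
    ContDiffOn ℝ (⊤ : ℕ∞) (uncurry T) (Ioo t₀ 0 ×ˢ ({x₀}ᶜ : Set E3)) →
    (∀ t ∈ Ioo t₀ 0, ∀ x, ‖v t x‖ ≤ V t) →
    CurledLaw v x₀ T (Ioo t₀ 0) →
    (∀ t ∈ Ioo t₀ 0, ∀ r > 0, IsUnimodalSphere (T t) x₀ r) →
    ∃ ℓp ℓm : ℝ → ℝ → ℝ,
      ContinuousOn (fun p : ℝ × ℝ => netFlux (T p.1) x₀ p.2) (Ioo t₀ 0 ×ˢ Ioi 0) ∧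
      (∀ t ∈ Ioo t₀ 0, ∀ r > 0, HasDerivWithinAt (fun ρ => netFlux (T t) x₀ ρ) (ℓp t r) (Ioi r) r) ∧
      (∀ t ∈ Ioo t₀ 0, ∀ r > 0, HasDerivWithinAt (fun ρ => netFlux (T t) x₀ ρ) (ℓm t r) (Iio r) r) ∧
      (∀ t ∈ Ioo t₀ 0, ∀ a R : ℝ, 0 < a → a < R → ∀ ε > 0, ∃ δ > 0, ∀ h ∈ Ioo 0 δ,
          (∫ r in Ioo a R, netFlux (T t) x₀ r) - (∫ r in Ioo a R, netFlux (T (t - h)) x₀ r)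
            ≤ h * (ℓp t R - ℓm t a + V t * (netFlux (T t) x₀ R + netFlux (T t) x₀ a) + ε))

/-- **(NC, S, NS kinematics near the centre.)**  For `v` smooth on the window with `curl v = ∇T × (x − x₀)`, `T` smooth off `x₀`:
`ω(t,x₀) = 0` (the hypothesis at `x = x₀` reads `curl v = cross _ 0 = 0`), so `‖ω‖, ‖ω_t‖ ≤ M‖x − x₀‖` on `[t₁,t₂] × B̄(x₀,1)`;
with `∇_S T = (ŷ × ω)/r` and `∇_S(∂_r T) = r⁻¹ ŷ × (∂_r ω)` one gets (a) `w(t,a) = a·osc_{S_a}T(t) ≤ πM a²`, (b) the a.e. derivative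
`∂_a w = osc + a(T_r(x̂⁺) − T_r(x̂⁻))` is `≤ 2πM a` in size, so `w(t,·)` is `2πM a₀`-Lipschitz on `(0,a₀)`, and (c) comparing `T(t,·)`,
`T(t',·)` after subtracting their values at the reference point `x₀ + a e` of the SAME sphere (osc is shift-invariant):
`|w(t,a) − w(t',a)| ≤ 2π M a²|t − t'|` — all uniformly for `t, t' ∈ [t₁,t₂] ⊂ (t₀,0)`.  Used by (WD) to make the `r = a` terms of (L)
and the `∫₀^a` remainder vanish as `a ↓ 0`. -/
def NearCentreFlux : Prop :=
  ∀ (v : ℝ → E3 → E3) (x₀ : E3) (T : ℝ → E3 → ℝ) (t₀ t₁ t₂ : ℝ), t₀ < t₁ → t₁ ≤ t₂ → t₂ < 0 →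
    ContDiffOn ℝ (⊤ : ℕ∞) (uncurry v) (Ioo t₀ 0 ×ˢ univ) →
    ContDiffOn ℝ (⊤ : ℕ∞) (uncurry T) (Ioo t₀ 0 ×ˢ ({x₀}ᶜ : Set E3)) →
    (∀ t ∈ Ioo t₀ 0, ∀ x, curl (v t) x = cross (gradient (T t) x) (x - x₀)) →
    ∃ κ : ℝ, 0 ≤ κ ∧ ∀ a₀ : ℝ, 0 < a₀ → a₀ ≤ 1 →
      (∀ t ∈ Icc t₁ t₂,
        (∀ a ∈ Ioo 0 a₀, netFlux (T t) x₀ a ≤ κ * a ^ 2) ∧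
        LipschitzOnWith (Real.toNNReal (κ * a₀)) (fun r => netFlux (T t) x₀ r) (Ioo 0 a₀)) ∧
      (∀ t ∈ Icc t₁ t₂, ∀ t' ∈ Icc t₁ t₂, ∀ a ∈ Ioo 0 a₀,
        |netFlux (T t) x₀ a - netFlux (T t') x₀ a| ≤ κ * a ^ 2 * |t - t'|)

end Summit.NavierStokesRegularity.NavierStokesRegularity.Theorems.PoloidalLiouville.NetFlux

end
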